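import Summits.AtomisticToContinuum.HydrodynamicLimit.Theorems.TwoClocksEquilibriumFastWindowLDBirthT12GainDipoleB
import Summits.AtomisticToContinuum.HydrodynamicLimit.Theorems.TwoClocksEquilibriumFastWindowLDBirthT12GainRadialGrowth
import HarnessLib

/-!
# (e-K₂) on the DIPOLE sector, III: the Carleman slice representation of the true gain term on dipole
# fields `u(x) = ⟪a, x⟫ Θ(‖x‖)` for amplitudes `Θ` of POLYNOMIAL growth
# (helper `t12_gainTerm_dipole_slice_growth` of the line `birth`, crux `TwoClocks.EquilibriumFastWindowLD`,
# stmt-AtomisticToContinuum-14440; infrastructure (e-K₂), `ℓ = 1` bootstrap, towards the registered analytic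
# sub-goal `t12_logLinearPreimage_and_dipoleModulus`, plan §5)

Continuation of `…T12GainDipole(B)` (dipole fields with BOUNDED amplitude `|Θ| ≤ m`: slice representation and
the comparison `|gainTerm u v - lorentzGain u v| ≤ 2π m ‖a‖ (16 + 29‖v‖)`). The `ℓ = 1` assembly of the corrector
analysis meets the dipole profile `Φ` of `Π₁ψ₀` at its CURRENT a-priori size — amplitude `Θ = ‖Φ‖/r` in the
lin-log class `(1 + t)(1 + log(1 + t))` in the first round, in the log class `1 + log(1 + t)` in the second — and
each round consumes the comparison of the true gain term with its Lorentz limit for THAT class. As for the zonal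
sector (`…T12GainRadialGrowth(B)`) the comparison is proved once for a general weight of polynomial increment
(sibling file `…T12GainDipoleGrowthB`); this file supplies the growth-insensitive ingredient, the exact slice
representation, for every measurable amplitude of POLYNOMIAL growth `|Θ t| ≤ C (1 + t)ᵏ` on `[0, ∞)`:

* the dipole field has size `|⟪a, x⟫ Θ(‖x‖)| ≤ ‖a‖ · C(1 + ‖x‖)ᵏ⁺¹` (`abs_dipole_le_poly`), a radial weight of
  Gaussian growth `C(1 + r)ᵏ⁺¹ ≤ C e^{(k+1)²} e^{r²/4}` (`polyWeight_gaussGrowth`), so both Fubini exchanges of the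
  slice method are dominated by the radial ones of `…T12GainRadialGrowth` (`integrable_gainFst_dipole_prod_poly`,
  `integrable_dipole_slice_prod_poly`);
* the slice on the sphere (hat-box for `⟪a, v⟫`, Funk–Hecke for `P₁` for `⟪a, ω⟫`) only evaluates `Θ` at radii
  `√(S² - ⟪v, ω⟫² + t²) ≤ S + |t|`, so it is the bounded-amplitude identity `sphereIntegral_dipole_slice_eq` applied
  to the TRUNCATION `1_{(-∞, S+|t|]} Θ` (`sphereIntegral_dipole_slice_eq_poly`);
* whence (registered **`t12_gainTerm_dipole_slice_growth`**; `gainTerm_dipole_eq_slice_poly`), for unit `n`, `0 ≤ S`,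
  `γ = gaussianReal 0 1`: `gainTerm u (S n) = 4π ⟪a, n⟫ ∫ γ(dt) J(t)`,
  `J(t) = ∫_{-1}^{1} (S x - t)₊ (S - (S x - t) x) Θ(√(S² - (S x)² + t²)) dx`, the Lorentz operator is the slice `t = 0`
  (`lorentzGain_dipole_eq_slice_poly`) and `gainTerm u - lorentzGain u = 4π ⟪a, n⟫ ∫ γ(dt) (J(t) - J(0))`
  (`gainTerm_sub_lorentzGain_dipole_eq_poly`).

[folklore] (Carleman 1933 / Hilbert 1912 representation; Funk 1916 / Hecke 1918; Grad 1963 §4;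
Cercignani–Illner–Pulvirenti 1994 §7.2; (e-K₂) of the corrector-growth plan of the line `birth`).
-/

noncomputable section

open MeasureTheory ProbabilityTheory Real Set Filter Metric
open scoped ENNReal BigOperators InnerProductSpace
namespace Summit.AtomisticToContinuum.HydrodynamicLimit.Theorems.ClampedCorrectorBirth

open Literature.Analysis.FluidPDE Literature.MathematicalPhysics.KineticTheory
open Literature.Analysis.UnboundedOperators Literature.Probability.Distributions

variable {Θ : ℝ → ℝ} {C : ℝ} {k : ℕ} {v : EuclideanSpace ℝ (Fin 3)}

/-! ### Polynomial growth of the amplitude: size of the dipole field, Gaussian growth, truncation -/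

/-- Polynomial growth `|Θ t| ≤ C (1 + t)ᵏ` on `[0, ∞)` forces `0 ≤ C`. [folklore] -/
theorem nonneg_of_polyGrowth (hp : ∀ t : ℝ, 0 ≤ t → |Θ t| ≤ C * (1 + t) ^ k) : 0 ≤ C := by
  have h := hp 0 le_rfl
  rw [add_zero, one_pow, mul_one] at h
  exact (abs_nonneg _).trans h

/-- `(1 + t)ʲ ≤ e^{j²} e^{t²/4}` for `t ≥ 0` (`1 + t ≤ eᵗ` and `jt ≤ j² + t²/4`). [folklore] -/
theorem one_add_pow_le_exp_sq_mul_exp (j : ℕ) {t : ℝ} (ht : 0 ≤ t) :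
    (1 + t) ^ j ≤ Real.exp ((j : ℝ) ^ 2) * Real.exp (t ^ 2 / 4) := by
  rw [← Real.exp_add]
  calc (1 + t) ^ j ≤ Real.exp t ^ j := pow_le_pow_left₀ (by positivity) (by linarith [Real.add_one_le_exp t]) j
    _ = Real.exp (j * t) := (Real.exp_nat_mul t j).symm
    _ ≤ Real.exp ((j : ℝ) ^ 2 + t ^ 2 / 4) := Real.exp_le_exp.2 (by nlinarith [sq_nonneg ((j : ℝ) - t / 2)])

/-- The radial comparison weight `r ↦ C (1 + r)ᵏ⁺¹` of a dipole field of polynomial growth has GAUSSIAN growth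
`≤ C e^{(k+1)²} · e^{r²/4}` on `[0, ∞)` (`0 ≤ C`), the class of `…T12GainRadialGrowth`. [folklore] -/
theorem polyWeight_gaussGrowth (hC : 0 ≤ C) (r : ℝ) (hr : 0 ≤ r) :
    |C * (1 + r) ^ (k + 1)| ≤ C * Real.exp (((k + 1 : ℕ) : ℝ) ^ 2) * Real.exp (r ^ 2 / 4) := by
  rw [abs_of_nonneg (by positivity), mul_assoc]
  exact mul_le_mul_of_nonneg_left (one_add_pow_le_exp_sq_mul_exp (k + 1) hr) hC

/-- A dipole field with amplitude of polynomial growth: `|⟪a, x⟫ Θ(‖x‖)| ≤ ‖a‖ · C (1 + ‖x‖)ᵏ⁺¹`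
(`|⟪a, x⟫| ≤ ‖a‖ ‖x‖ ≤ ‖a‖ (1 + ‖x‖)`). [folklore] -/
theorem abs_dipole_le_poly (hp : ∀ t : ℝ, 0 ≤ t → |Θ t| ≤ C * (1 + t) ^ k) (a x : EuclideanSpace ℝ (Fin 3)) :
    |⟪a, x⟫_ℝ * Θ ‖x‖| ≤ ‖a‖ * (C * (1 + ‖x‖) ^ (k + 1)) := by
  have hC := nonneg_of_polyGrowth hp
  rw [abs_mul]
  calc |⟪a, x⟫_ℝ| * |Θ ‖x‖| ≤ (‖a‖ * ‖x‖) * (C * (1 + ‖x‖) ^ k) :=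
        mul_le_mul (abs_real_inner_le_norm a x) (hp _ (norm_nonneg x)) (abs_nonneg _) (by positivity)
    _ ≤ (‖a‖ * (1 + ‖x‖)) * (C * (1 + ‖x‖) ^ k) := by gcongr; linarith
    _ = ‖a‖ * (C * (1 + ‖x‖) ^ (k + 1)) := by ring

/-- The dipole slice amplitude under polynomial growth: with `q = ‖v‖² - ⟪v, ω⟫² + t²`,
`|(⟪a, v⟫ - (⟪v, ω⟫ - t)⟪a, ω⟫) Θ(√q)| ≤ ‖a‖ · C (1 + √q)ᵏ⁺¹` (`abs_dipole_amplitude_le`). [folklore] -/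
theorem abs_dipole_amplitude_mul_le_poly (hp : ∀ t : ℝ, 0 ≤ t → |Θ t| ≤ C * (1 + t) ^ k)
    (a v : EuclideanSpace ℝ (Fin 3)) (ω : sphere (0 : EuclideanSpace ℝ (Fin 3)) 1) (t : ℝ) :
    |(⟪a, v⟫_ℝ - (⟪v, ω⟫_ℝ - t) * ⟪a, ω⟫_ℝ) * Θ (√(‖v‖ ^ 2 - ⟪v, ω⟫_ℝ ^ 2 + t ^ 2))| ≤
      ‖a‖ * (C * (1 + √(‖v‖ ^ 2 - ⟪v, ω⟫_ℝ ^ 2 + t ^ 2)) ^ (k + 1)) := by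
  have hC := nonneg_of_polyGrowth hp
  rw [abs_mul]
  calc |⟪a, v⟫_ℝ - (⟪v, ω⟫_ℝ - t) * ⟪a, ω⟫_ℝ| * |Θ (√(‖v‖ ^ 2 - ⟪v, ω⟫_ℝ ^ 2 + t ^ 2))|
      ≤ (‖a‖ * √(‖v‖ ^ 2 - ⟪v, ω⟫_ℝ ^ 2 + t ^ 2)) * (C * (1 + √(‖v‖ ^ 2 - ⟪v, ω⟫_ℝ ^ 2 + t ^ 2)) ^ k) :=
        mul_le_mul (abs_dipole_amplitude_le a v ω t) (hp _ (sqrt_nonneg _)) (abs_nonneg _) (by positivity)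
    _ ≤ (‖a‖ * (1 + √(‖v‖ ^ 2 - ⟪v, ω⟫_ℝ ^ 2 + t ^ 2))) * (C * (1 + √(‖v‖ ^ 2 - ⟪v, ω⟫_ℝ ^ 2 + t ^ 2)) ^ k) := by
        gcongr
        linarith [sqrt_nonneg (‖v‖ ^ 2 - ⟪v, ω⟫_ℝ ^ 2 + t ^ 2)]
    _ = ‖a‖ * (C * (1 + √(‖v‖ ^ 2 - ⟪v, ω⟫_ℝ ^ 2 + t ^ 2)) ^ (k + 1)) := by ring

/-- **Truncation of the amplitude beyond a radius**: `Θ_R = 1_{(-∞, R]} Θ` is bounded by `C (1 + R)ᵏ` on `[0, ∞)`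
under polynomial growth (`0 ≤ R`). [folklore] -/
theorem abs_truncate_le_poly (hp : ∀ t : ℝ, 0 ≤ t → |Θ t| ≤ C * (1 + t) ^ k) {R : ℝ} (hR : 0 ≤ R)
    (r : ℝ) (hr : 0 ≤ r) : |(Iic R).indicator Θ r| ≤ C * (1 + R) ^ k := by
  have hC := nonneg_of_polyGrowth hp
  by_cases h : r ∈ Iic R
  · rw [indicator_of_mem h]
    refine (hp r hr).trans ?_
    gcongr
    exact h
  · rw [indicator_of_notMem h, abs_zero]
    positivity

/-- The slice never sees radii beyond `‖v‖ + |t|`: `1_{(-∞, ‖v‖+|t|]} Θ (√(‖v‖² - b² + t²)) = Θ(√(‖v‖² - b² + t²))`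
for every `b` (`sqrt_sq_sub_sq_add_sq_le`). [folklore] -/
theorem truncate_comp_sqrt_slice (Θ : ℝ → ℝ) (v : EuclideanSpace ℝ (Fin 3)) (t b : ℝ) :
    (Iic (‖v‖ + |t|)).indicator Θ (√(‖v‖ ^ 2 - b ^ 2 + t ^ 2)) = Θ (√(‖v‖ ^ 2 - b ^ 2 + t ^ 2)) :=
  indicator_of_mem (show √(‖v‖ ^ 2 - b ^ 2 + t ^ 2) ∈ Iic (‖v‖ + |t|) from
    sqrt_sq_sub_sq_add_sq_le (norm_nonneg v) b t) Θ

/-! ### Integrability on the two product spaces (domination by the radial weight `C (1 + ‖·‖)ᵏ⁺¹`) -/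

/-- **Integrability of the own-particle dipole integrand on `M ⊗ σ`** under polynomial growth:
`(w, ω) ↦ ((v - w)·ω)₊ ⟪a, v'⟫ Θ(‖v'‖)` is dominated by `‖a‖` times the radial integrand of the Gaussian-growth
weight `C (1 + ‖·‖)ᵏ⁺¹` (`integrable_gainFst_radial_prod_gauss`). [folklore] -/
theorem integrable_gainFst_dipole_prod_poly (a : EuclideanSpace ℝ (Fin 3)) (hΘ : Measurable Θ)
    (hp : ∀ t : ℝ, 0 ≤ t → |Θ t| ≤ C * (1 + t) ^ k) (v : EuclideanSpace ℝ (Fin 3)) :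
    Integrable (Function.uncurry fun (w : EuclideanSpace ℝ (Fin 3)) (ω : sphere (0 : EuclideanSpace ℝ (Fin 3)) 1) =>
        hardSphereKernel (v, w) ω * (⟪a, (collide ω (v, w)).1⟫_ℝ * Θ ‖(collide ω (v, w)).1‖))
      ((stdGaussian (EuclideanSpace ℝ (Fin 3))).prod (sphereMeasure : Measure (sphere (0 : EuclideanSpace ℝ (Fin 3)) 1))) := by
  have hC := nonneg_of_polyGrowth hp
  have h := ((integrable_gainFst_radial_prod_gauss (G := fun r => C * (1 + r) ^ (k + 1)) (by fun_prop)
    (polyWeight_gaussGrowth hC) v).norm.const_mul ‖a‖)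
  have hB : Continuous fun p : EuclideanSpace ℝ (Fin 3) × sphere (0 : EuclideanSpace ℝ (Fin 3)) 1 =>
      hardSphereKernel (v, p.1) p.2 := by unfold hardSphereKernel; fun_prop
  have hP : Continuous fun p : EuclideanSpace ℝ (Fin 3) × sphere (0 : EuclideanSpace ℝ (Fin 3)) 1 =>
      (collide p.2 (v, p.1)).1 := by unfold collide; fun_prop
  refine h.mono' (hB.measurable.mul ((measurable_const.inner hP.measurable).mul
    (hΘ.comp hP.norm.measurable))).aestronglyMeasurable (Eventually.of_forall fun p => ?_)
  rcases p with ⟨w, ω⟩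
  simp only [Function.uncurry_apply_pair, Real.norm_eq_abs]
  calc |hardSphereKernel (v, w) ω * (⟪a, (collide ω (v, w)).1⟫_ℝ * Θ ‖(collide ω (v, w)).1‖)|
      = |hardSphereKernel (v, w) ω| * |⟪a, (collide ω (v, w)).1⟫_ℝ * Θ ‖(collide ω (v, w)).1‖| := abs_mul _ _
    _ ≤ |hardSphereKernel (v, w) ω| * (‖a‖ * (C * (1 + ‖(collide ω (v, w)).1‖) ^ (k + 1))) :=
        mul_le_mul_of_nonneg_left (abs_dipole_le_poly hp a _) (abs_nonneg _)
    _ = ‖a‖ * |hardSphereKernel (v, w) ω * (C * (1 + ‖(collide ω (v, w)).1‖) ^ (k + 1))| := by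
        rw [abs_mul, abs_of_nonneg (by positivity : (0:ℝ) ≤ C * (1 + ‖(collide ω (v, w)).1‖) ^ (k + 1))]
        ring

/-- **Integrability of the dipole slice integrand on `σ ⊗ γ`** under polynomial growth:
`(ω, t) ↦ (⟪v, ω⟫ - t)₊ (⟪a, v⟫ - (⟪v, ω⟫ - t)⟪a, ω⟫) Θ(√(‖v‖² - ⟪v, ω⟫² + t²))` is dominated by `‖a‖` times the
radial slice integrand of the weight `C (1 + ‖·‖)ᵏ⁺¹` (`integrable_slice_prod_gauss`). [folklore] -/
theorem integrable_dipole_slice_prod_poly (a : EuclideanSpace ℝ (Fin 3)) (hΘ : Measurable Θ)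
    (hp : ∀ t : ℝ, 0 ≤ t → |Θ t| ≤ C * (1 + t) ^ k) (v : EuclideanSpace ℝ (Fin 3)) :
    Integrable (Function.uncurry fun (ω : sphere (0 : EuclideanSpace ℝ (Fin 3)) 1) (t : ℝ) => max (⟪v, ω⟫_ℝ - t) 0 *
        ((⟪a, v⟫_ℝ - (⟪v, ω⟫_ℝ - t) * ⟪a, ω⟫_ℝ) * Θ (√(‖v‖ ^ 2 - ⟪v, ω⟫_ℝ ^ 2 + t ^ 2))))
      ((sphereMeasure : Measure (sphere (0 : EuclideanSpace ℝ (Fin 3)) 1)).prod (gaussianReal 0 1)) := by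
  have hC := nonneg_of_polyGrowth hp
  have h := ((integrable_slice_prod_gauss (G := fun r => C * (1 + r) ^ (k + 1)) (by fun_prop)
    (polyWeight_gaussGrowth hC) v).norm.const_mul ‖a‖)
  have hmeas : Measurable (Function.uncurry fun (ω : sphere (0 : EuclideanSpace ℝ (Fin 3)) 1) (t : ℝ) =>
      max (⟪v, ω⟫_ℝ - t) 0 * ((⟪a, v⟫_ℝ - (⟪v, ω⟫_ℝ - t) * ⟪a, ω⟫_ℝ) * Θ (√(‖v‖ ^ 2 - ⟪v, ω⟫_ℝ ^ 2 + t ^ 2)))) := by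
    refine Measurable.mul (by fun_prop) (Measurable.mul (by fun_prop) (hΘ.comp ?_))
    fun_prop
  refine h.mono' hmeas.aestronglyMeasurable (Eventually.of_forall fun p => ?_)
  rcases p with ⟨ω, t⟩
  simp only [Function.uncurry_apply_pair, Real.norm_eq_abs]
  calc |max (⟪v, ω⟫_ℝ - t) 0 * ((⟪a, v⟫_ℝ - (⟪v, ω⟫_ℝ - t) * ⟪a, ω⟫_ℝ) * Θ (√(‖v‖ ^ 2 - ⟪v, ω⟫_ℝ ^ 2 + t ^ 2)))|
      = max (⟪v, ω⟫_ℝ - t) 0 * |(⟪a, v⟫_ℝ - (⟪v, ω⟫_ℝ - t) * ⟪a, ω⟫_ℝ) * Θ (√(‖v‖ ^ 2 - ⟪v, ω⟫_ℝ ^ 2 + t ^ 2))| := by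
        rw [abs_mul, abs_of_nonneg (le_max_right _ _)]
    _ ≤ max (⟪v, ω⟫_ℝ - t) 0 * (‖a‖ * (C * (1 + √(‖v‖ ^ 2 - ⟪v, ω⟫_ℝ ^ 2 + t ^ 2)) ^ (k + 1))) :=
        mul_le_mul_of_nonneg_left (abs_dipole_amplitude_mul_le_poly hp a v ω t) (le_max_right _ _)
    _ = ‖a‖ * |max (⟪v, ω⟫_ℝ - t) 0 * (C * (1 + √(‖v‖ ^ 2 - ⟪v, ω⟫_ℝ ^ 2 + t ^ 2)) ^ (k + 1))| := by
        rw [abs_of_nonneg (by positivity :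
          (0:ℝ) ≤ max (⟪v, ω⟫_ℝ - t) 0 * (C * (1 + √(‖v‖ ^ 2 - ⟪v, ω⟫_ℝ ^ 2 + t ^ 2)) ^ (k + 1)))]
        ring

/-! ### The slice on the sphere by truncation, and the exact slice representations -/

/-- **The `t`-slice of the dipole field on the sphere** under polynomial growth: for unit `n` with
`⟪v, ·⟫ = ‖v‖ ⟪n, ·⟫`, `S = ‖v‖` and every real `t`,
`∫_{S²} (⟪v, ω⟫ - t)₊ (⟪a, v⟫ - (⟪v, ω⟫ - t)⟪a, ω⟫) Θ(√(S² - ⟪v, ω⟫² + t²)) dσ(ω)`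
`= 2π ⟪a, n⟫ ∫_{-1}^{1} (S x - t)₊ (S - (S x - t) x) Θ(√(S² - (S x)² + t²)) dx` — both sides only evaluate `Θ` at
radii `≤ S + |t|`, where `Θ` agrees with its bounded truncation (`sphereIntegral_dipole_slice_eq`). [folklore] -/
theorem sphereIntegral_dipole_slice_eq_poly (a : EuclideanSpace ℝ (Fin 3)) (hΘ : Measurable Θ)
    (hp : ∀ t : ℝ, 0 ≤ t → |Θ t| ≤ C * (1 + t) ^ k) {n : EuclideanSpace ℝ (Fin 3)} (hn : ‖n‖ = 1)
    (hvn : ∀ x : EuclideanSpace ℝ (Fin 3), ⟪v, x⟫_ℝ = ‖v‖ * ⟪n, x⟫_ℝ) (t : ℝ) :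
    ∫ ω : sphere (0 : EuclideanSpace ℝ (Fin 3)) 1, max (⟪v, ω⟫_ℝ - t) 0 *
        ((⟪a, v⟫_ℝ - (⟪v, ω⟫_ℝ - t) * ⟪a, ω⟫_ℝ) * Θ (√(‖v‖ ^ 2 - ⟪v, ω⟫_ℝ ^ 2 + t ^ 2))) ∂sphereMeasure =
      2 * π * ⟪a, n⟫_ℝ * ∫ x in (-1:ℝ)..1,
        max (‖v‖ * x - t) 0 * (‖v‖ - (‖v‖ * x - t) * x) * Θ (√(‖v‖ ^ 2 - (‖v‖ * x) ^ 2 + t ^ 2)) := by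
  have h := sphereIntegral_dipole_slice_eq a (hΘ.indicator measurableSet_Iic)
    (abs_truncate_le_poly hp (by positivity : (0:ℝ) ≤ ‖v‖ + |t|)) hn hvn t
  simp_rw [truncate_comp_sqrt_slice] at h
  exact h

/-- **The own piece of the dipole field in slice form** under polynomial growth: for unit `n` with
`⟪v, ·⟫ = ‖v‖⟪n, ·⟫` and `S = ‖v‖`,
`∫ dM(w) ∫_{S²} ((v - w)·ω)₊ ⟪a, v'⟫ Θ(‖v'‖) dσ(ω) = 2π ⟪a, n⟫ ∫ γ(dt) ∫_{-1}^{1} (S x - t)₊ (S - (S x - t) x) Θ(√(S² - (S x)² + t²)) dx`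
(Fubini on `M ⊗ σ`, the Gaussian projection `t = ⟪w, ω⟫ ∼ γ`, Fubini on `σ ⊗ γ`, the slice on the sphere). [folklore] -/
theorem gainFst_dipole_eq_slice_poly (a : EuclideanSpace ℝ (Fin 3)) (hΘ : Measurable Θ)
    (hp : ∀ t : ℝ, 0 ≤ t → |Θ t| ≤ C * (1 + t) ^ k) {n : EuclideanSpace ℝ (Fin 3)} (hn : ‖n‖ = 1)
    (hvn : ∀ x : EuclideanSpace ℝ (Fin 3), ⟪v, x⟫_ℝ = ‖v‖ * ⟪n, x⟫_ℝ) :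
    ∫ w, ∫ ω, hardSphereKernel (v, w) ω * (⟪a, (collide ω (v, w)).1⟫_ℝ * Θ ‖(collide ω (v, w)).1‖) ∂sphereMeasure
        ∂stdGaussian (EuclideanSpace ℝ (Fin 3)) =
      2 * π * ⟪a, n⟫_ℝ * ∫ t, (∫ x in (-1:ℝ)..1,
        max (‖v‖ * x - t) 0 * (‖v‖ - (‖v‖ * x - t) * x) * Θ (√(‖v‖ ^ 2 - (‖v‖ * x) ^ 2 + t ^ 2))) ∂gaussianReal 0 1 := by
  haveI := isFiniteMeasure_sphereMeasure (E := EuclideanSpace ℝ (Fin 3))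
  calc ∫ w, ∫ ω, hardSphereKernel (v, w) ω * (⟪a, (collide ω (v, w)).1⟫_ℝ * Θ ‖(collide ω (v, w)).1‖) ∂sphereMeasure
          ∂stdGaussian (EuclideanSpace ℝ (Fin 3))
      = ∫ ω, ∫ w, hardSphereKernel (v, w) ω * (⟪a, (collide ω (v, w)).1⟫_ℝ * Θ ‖(collide ω (v, w)).1‖)
          ∂stdGaussian (EuclideanSpace ℝ (Fin 3)) ∂sphereMeasure :=
        integral_integral_swap (integrable_gainFst_dipole_prod_poly a hΘ hp v)
    _ = ∫ ω : sphere (0 : EuclideanSpace ℝ (Fin 3)) 1, ∫ t, max (⟪v, ω⟫_ℝ - t) 0 *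
          ((⟪a, v⟫_ℝ - (⟪v, ω⟫_ℝ - t) * ⟪a, ω⟫_ℝ) * Θ (√(‖v‖ ^ 2 - ⟪v, ω⟫_ℝ ^ 2 + t ^ 2)))
            ∂gaussianReal 0 1 ∂sphereMeasure := by
        refine integral_congr_ae (Eventually.of_forall fun ω => ?_)
        dsimp only
        simp_rw [hardSphereKernel_mul_dipole_collide_fst]
        exact integral_stdGaussian_comp_inner_sphere ω (h := fun t => max (⟪v, ω⟫_ℝ - t) 0 *
          ((⟪a, v⟫_ℝ - (⟪v, ω⟫_ℝ - t) * ⟪a, ω⟫_ℝ) * Θ (√(‖v‖ ^ 2 - ⟪v, ω⟫_ℝ ^ 2 + t ^ 2)))) (by fun_prop)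
    _ = ∫ t, ∫ ω : sphere (0 : EuclideanSpace ℝ (Fin 3)) 1, max (⟪v, ω⟫_ℝ - t) 0 *
          ((⟪a, v⟫_ℝ - (⟪v, ω⟫_ℝ - t) * ⟪a, ω⟫_ℝ) * Θ (√(‖v‖ ^ 2 - ⟪v, ω⟫_ℝ ^ 2 + t ^ 2)))
            ∂sphereMeasure ∂gaussianReal 0 1 :=
        integral_integral_swap (integrable_dipole_slice_prod_poly a hΘ hp v)
    _ = ∫ t, 2 * π * ⟪a, n⟫_ℝ * (∫ x in (-1:ℝ)..1,
          max (‖v‖ * x - t) 0 * (‖v‖ - (‖v‖ * x - t) * x) * Θ (√(‖v‖ ^ 2 - (‖v‖ * x) ^ 2 + t ^ 2))) ∂gaussianReal 0 1 :=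
        integral_congr_ae (Eventually.of_forall fun t => sphereIntegral_dipole_slice_eq_poly a hΘ hp hn hvn t)
    _ = _ := integral_const_mul _ _

/-- **The dipole slice is `γ`-integrable** under polynomial growth:
`t ↦ ∫_{-1}^{1} (S x - t)₊ (S - (S x - t) x) Θ(√(S² - (S x)² + t²)) dx ∈ L¹(γ)` (`S = ‖v‖`; the slice with `a = n`). [folklore] -/
theorem integrable_dipole_slice_poly (hΘ : Measurable Θ) (hp : ∀ t : ℝ, 0 ≤ t → |Θ t| ≤ C * (1 + t) ^ k)
    (v : EuclideanSpace ℝ (Fin 3)) :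
    Integrable (fun t => ∫ x in (-1:ℝ)..1,
      max (‖v‖ * x - t) 0 * (‖v‖ - (‖v‖ * x - t) * x) * Θ (√(‖v‖ ^ 2 - (‖v‖ * x) ^ 2 + t ^ 2))) (gaussianReal 0 1) := by
  haveI := isFiniteMeasure_sphereMeasure (E := EuclideanSpace ℝ (Fin 3))
  obtain ⟨n, hn, hvn⟩ := exists_unit_inner_eq v
  have h := ((integrable_dipole_slice_prod_poly n hΘ hp v).integral_prod_right).congr
    (Eventually.of_forall fun t => sphereIntegral_dipole_slice_eq_poly n hΘ hp hn hvn t)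
  have hnn : ⟪n, n⟫_ℝ = 1 := by rw [real_inner_self_eq_norm_sq, hn, one_pow]
  refine (h.const_mul (2 * π)⁻¹).congr (Eventually.of_forall fun t => ?_)
  dsimp only
  rw [hnn, mul_one, ← mul_assoc, inv_mul_cancel₀ (by positivity), one_mul]

/-- **The true gain term on dipole fields in slice form** under polynomial growth: for unit `n` with
`⟪v, ·⟫ = ‖v‖⟪n, ·⟫`, `S = ‖v‖`:
`gainTerm (⟪a, ·⟫ Θ(‖·‖)) v = 4π ⟪a, n⟫ ∫ γ(dt) ∫_{-1}^{1} (S x - t)₊ (S - (S x - t) x) Θ(√(S² - (S x)² + t²)) dx`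
(exchange symmetry: twice the own piece). [folklore] -/
theorem gainTerm_dipole_eq_slice_poly (a : EuclideanSpace ℝ (Fin 3)) (hΘ : Measurable Θ)
    (hp : ∀ t : ℝ, 0 ≤ t → |Θ t| ≤ C * (1 + t) ^ k) {n : EuclideanSpace ℝ (Fin 3)} (hn : ‖n‖ = 1)
    (hvn : ∀ x : EuclideanSpace ℝ (Fin 3), ⟪v, x⟫_ℝ = ‖v‖ * ⟪n, x⟫_ℝ) :
    gainTerm (fun x => ⟪a, x⟫_ℝ * Θ ‖x‖) v = 4 * π * ⟪a, n⟫_ℝ * ∫ t, (∫ x in (-1:ℝ)..1,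
      max (‖v‖ * x - t) 0 * (‖v‖ - (‖v‖ * x - t) * x) * Θ (√(‖v‖ ^ 2 - (‖v‖ * x) ^ 2 + t ^ 2))) ∂gaussianReal 0 1 := by
  have hu : Measurable fun x : EuclideanSpace ℝ (Fin 3) => ⟪a, x⟫_ℝ * Θ ‖x‖ := by fun_prop
  have h2 : ∫ w, ∫ ω, hardSphereKernel (v, w) ω * (⟪a, (collide ω (v, w)).2⟫_ℝ * Θ ‖(collide ω (v, w)).2‖)
        ∂sphereMeasure ∂stdGaussian (EuclideanSpace ℝ (Fin 3)) =
      ∫ w, ∫ ω, hardSphereKernel (v, w) ω * (⟪a, (collide ω (v, w)).1⟫_ℝ * Θ ‖(collide ω (v, w)).1‖)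
        ∂sphereMeasure ∂stdGaussian (EuclideanSpace ℝ (Fin 3)) :=
    integral_congr_ae (Eventually.of_forall fun w => (gainFst_eq_gainSnd v w hu).symm)
  simp only [gainTerm]
  rw [h2, gainFst_dipole_eq_slice_poly a hΘ hp hn hvn]
  ring

/-- **The Lorentz operator on dipole fields is the slice `t = 0`** under polynomial growth: for unit `n` with
`⟪v, ·⟫ = ‖v‖⟪n, ·⟫`, `S = ‖v‖`:
`lorentzGain (⟪a, ·⟫ Θ(‖·‖)) v = 4π ⟪a, n⟫ ∫_{-1}^{1} (S x)₊ (S - S x²) Θ(√(S² - (S x)²)) dx` (partner at rest,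
`t = ⟪0, ω⟫ = 0`; `= (4π/S²) ⟪a, n⟫ ∫₀^S r³ Θ(r) dr`, the `ℓ = 1` Euler kernel). [folklore] -/
theorem lorentzGain_dipole_eq_slice_poly (a : EuclideanSpace ℝ (Fin 3)) (hΘ : Measurable Θ)
    (hp : ∀ t : ℝ, 0 ≤ t → |Θ t| ≤ C * (1 + t) ^ k) {n : EuclideanSpace ℝ (Fin 3)} (hn : ‖n‖ = 1)
    (hvn : ∀ x : EuclideanSpace ℝ (Fin 3), ⟪v, x⟫_ℝ = ‖v‖ * ⟪n, x⟫_ℝ) :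
    lorentzGain (fun x => ⟪a, x⟫_ℝ * Θ ‖x‖) v = 4 * π * ⟪a, n⟫_ℝ * ∫ x in (-1:ℝ)..1,
      max (‖v‖ * x) 0 * (‖v‖ - ‖v‖ * x * x) * Θ (√(‖v‖ ^ 2 - (‖v‖ * x) ^ 2)) := by
  have hu : Measurable fun x : EuclideanSpace ℝ (Fin 3) => ⟪a, x⟫_ℝ * Θ ‖x‖ := by fun_prop
  have h0 := gain_zero_eq_lorentzGain v hu
  have h1 := gainFst_eq_gainSnd v 0 hu
  have h3 : ∫ ω, hardSphereKernel (v, 0) ω * (⟪a, (collide ω (v, 0)).1⟫_ℝ * Θ ‖(collide ω (v, 0)).1‖) ∂sphereMeasure =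
      2 * π * ⟪a, n⟫_ℝ * ∫ x in (-1:ℝ)..1,
        max (‖v‖ * x - 0) 0 * (‖v‖ - (‖v‖ * x - 0) * x) * Θ (√(‖v‖ ^ 2 - (‖v‖ * x) ^ 2 + 0 ^ 2)) := by
    rw [← sphereIntegral_dipole_slice_eq_poly a hΘ hp hn hvn 0]
    refine integral_congr_ae (Eventually.of_forall fun ω => ?_)
    dsimp only
    rw [hardSphereKernel_mul_dipole_collide_fst, inner_zero_left]
  have h4 : (∫ x in (-1:ℝ)..1, max (‖v‖ * x - 0) 0 * (‖v‖ - (‖v‖ * x - 0) * x) * Θ (√(‖v‖ ^ 2 - (‖v‖ * x) ^ 2 + 0 ^ 2))) =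
      ∫ x in (-1:ℝ)..1, max (‖v‖ * x) 0 * (‖v‖ - ‖v‖ * x * x) * Θ (√(‖v‖ ^ 2 - (‖v‖ * x) ^ 2)) := by
    simp only [sub_zero, ne_eq, OfNat.ofNat_ne_zero, not_false_eq_true, zero_pow, add_zero]
  rw [h4] at h3
  simp only at h0 h1
  linarith

/-- **The (e-K₂) difference on dipole fields in slice form** under polynomial growth: for unit `n` with
`⟪v, ·⟫ = ‖v‖⟪n, ·⟫`, `S = ‖v‖`, `u = ⟪a, ·⟫ Θ(‖·‖)`: `gainTerm u v - lorentzGain u v = 4π ⟪a, n⟫ ∫ γ(dt) (J(t) - J(0))`,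
`J(t) = ∫_{-1}^{1} (S x - t)₊ (S - (S x - t) x) Θ(√(S² - (S x)² + t²)) dx`. [folklore] -/
theorem gainTerm_sub_lorentzGain_dipole_eq_poly (a : EuclideanSpace ℝ (Fin 3)) (hΘ : Measurable Θ)
    (hp : ∀ t : ℝ, 0 ≤ t → |Θ t| ≤ C * (1 + t) ^ k) {n : EuclideanSpace ℝ (Fin 3)} (hn : ‖n‖ = 1)
    (hvn : ∀ x : EuclideanSpace ℝ (Fin 3), ⟪v, x⟫_ℝ = ‖v‖ * ⟪n, x⟫_ℝ) :
    gainTerm (fun x => ⟪a, x⟫_ℝ * Θ ‖x‖) v - lorentzGain (fun x => ⟪a, x⟫_ℝ * Θ ‖x‖) v =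
      4 * π * ⟪a, n⟫_ℝ * ∫ t, ((∫ x in (-1:ℝ)..1,
          max (‖v‖ * x - t) 0 * (‖v‖ - (‖v‖ * x - t) * x) * Θ (√(‖v‖ ^ 2 - (‖v‖ * x) ^ 2 + t ^ 2))) -
        ∫ x in (-1:ℝ)..1, max (‖v‖ * x) 0 * (‖v‖ - ‖v‖ * x * x) * Θ (√(‖v‖ ^ 2 - (‖v‖ * x) ^ 2))) ∂gaussianReal 0 1 := by
  rw [gainTerm_dipole_eq_slice_poly a hΘ hp hn hvn, lorentzGain_dipole_eq_slice_poly a hΘ hp hn hvn,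
    integral_sub (integrable_dipole_slice_poly hΘ hp v) (integrable_const _), integral_const, probReal_univ, one_smul]
  ring

/-! ### Registered helper -/

/-- **Registered helper `t12_gainTerm_dipole_slice_growth` — the exact one-dimensional (Carleman slice)
representation of the true gain term on a DIPOLE field whose amplitude has POLYNOMIAL growth.** For `a ∈ ℝ³`,
`Θ : ℝ → ℝ` measurable with `|Θ t| ≤ C (1 + t)ᵏ` for `t ≥ 0` (every weight class of the `ℓ = 1` bootstrap: bounded,
`1 + log(1 + t)`, `(1 + t)(1 + log(1 + t))`, …), a unit vector `n` and `0 ≤ S` (`M = stdGaussian`, `σ` the surface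
measure of `S²`, `(v', w') = collide ω (v, w)`, `γ = gaussianReal 0 1`, `u(x) = ⟪a, x⟫ Θ(‖x‖)`):
`gainTerm u (S n) = ∫ dM(w) ∫_{S²} ((Sn-w)·ω)₊ u(v') dσ + ∫ dM(w) ∫_{S²} ((Sn-w)·ω)₊ u(w') dσ`
`= 4π ⟪a, n⟩ ∫ γ(dt) ∫_{-1}^{1} (S x - t)₊ (S - (S x - t) x) Θ(√(S² - (S x)² + t²)) dx`.
Extends `t12_gainTerm_dipole_slice` (bounded `Θ`) verbatim — exchange symmetry, Carleman's slice (flux `(p - t)₊`,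
speed `√(S² - p² + t²)` AND `⟪a, v'⟫ = ⟪a, v⟫ - (p - t)⟪a, ω⟫` through `t = ⟪w, ω⟫ ∼ γ` only), hat-box + Funk–Hecke
for `P₁` — the two new points being (i) the domination of both Fubini exchanges by the radial Gaussian-growth
weight `‖a‖ · C(1 + r)ᵏ⁺¹ ≤ ‖a‖ C e^{(k+1)²} e^{r²/4}` of `…T12GainRadialGrowth`, and (ii) the slice on the sphere
seeing only radii `≤ S + |t|`, where `Θ` is its bounded truncation. The Lorentz operator is the slice `t = 0`
(`lorentzGain_dipole_eq_slice_poly`), so (e-K₂) on the dipole sector in any growth class is the one-dimensional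
law comparison `4π⟪a, n⟫ ∫ γ(dt) (J(t) - J(0))` (`gainTerm_sub_lorentzGain_dipole_eq_poly`; estimate in
`…T12GainDipoleGrowthB`). [folklore] -/
theorem t12_gainTerm_dipole_slice_growth : ∀ (a : EuclideanSpace ℝ (Fin 3)) (Θ : ℝ → ℝ) (C : ℝ) (k : ℕ), Measurable Θ → (∀ t : ℝ, 0 ≤ t → |Θ t| ≤ C * (1 + t) ^ k) → ∀ n : EuclideanSpace ℝ (Fin 3), ‖n‖ = 1 → ∀ S : ℝ, 0 ≤ S → Summit.AtomisticToContinuum.HydrodynamicLimit.Theorems.ClampedCorrectorBirth.gainTerm (fun x : EuclideanSpace ℝ (Fin 3) => inner ℝ a x * Θ ‖x‖) (S • n) = 4 * Real.pi * inner ℝ a n * ∫ t, (∫ x in (-1:ℝ)..1, max (S * x - t) 0 * (S - (S * x - t) * x) * Θ (Real.sqrt (S ^ 2 - (S * x) ^ 2 + t ^ 2))) ∂ProbabilityTheory.gaussianReal 0 1 := by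
  intro a Θ C k hΘ hp n hn S hS
  have hS' : ‖S • n‖ = S := by rw [norm_smul, Real.norm_eq_abs, abs_of_nonneg hS, hn, mul_one]
  have hvn : ∀ x : EuclideanSpace ℝ (Fin 3), ⟪S • n, x⟫_ℝ = ‖S • n‖ * ⟪n, x⟫_ℝ := fun x => by
    rw [real_inner_smul_left, hS']
  have h := gainTerm_dipole_eq_slice_poly a hΘ hp hn hvn
  rwa [hS'] at h

end Summit.AtomisticToContinuum.HydrodynamicLimit.Theorems.ClampedCorrectorBirth

end
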